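import Summits.QuantumFields.YangMills.Theorems.UnitScaleTiltFluctuationComparisonRegPrRepAtHeightsCoreRowsFam
import Summits.QuantumFields.YangMills.Theorems.UnitScaleTiltFluctuationComparisonRegPrRepAtHeightsV3Fam
import HarnessLib

/-!
# `UnitScaleTiltFluctuationComparisonRegPrRepAtHeightsCoreRowsFamUpper` — THE v4 TWIN (★★OWNER RULING g26-№14 (F-2b), BILL §7 P22 «20520 side») of
# `…RepAtHeightsCoreV3FamUpper` (p566734): THE UPPER ONE-STEP TRIVIAL ENVELOPE OF THE ROWS FAMILY DATUM `AlphaInputsT3AC.dataOfCoreRows p π`, `p : ∀ K, PkgCoreRows F 𝔠 γ hγ hγ1 K`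
# (crux `FluctuationComparisonRegPrIntL`, stmt-QuantumFields-20520, skeleton v5kC → v5kD; cell ym3-torus, width seat ym-ust-20520-w2 g4)

Count-neutral helper (`--supports stmt-QuantumFields-20520`).  The (55)·(58) row is the record's `(runRows.steps k hk).fibre55Win` (R-g18-a windowed left weight, by name, so the
B2 re-proof of `fibre55Triv_of_fibre55WinAC` is inherited); the (41)_{k+1} exponent step is `expo5558_le_expo41_succ_CoreAC` at the seven χ-free leaves
`AlphaV3AC.stepResidualsV3Core_of_alpha … (runRows.steps k hk)` (★alpha-1's `AlphaInputsT3ACv3LaneCore`) — it reads the STEP rows only, never the (67)∕(71) row.  Proof =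
`…CoreV3FamUpper`'s VERBATIM with `PkgCoreV3 ↦ PkgCoreRows`, `runCore.steps ↦ runRows.steps`.  Nothing of [Balaban1985UV3] is asserted; CONDITIONAL on the family `p`.
YM₃ on T³ is rung R3 of the programme, not the Clay problem.

References: T. Bałaban, CMP 102 (1985) 255–275 [Balaban1985UV3] ((40)–(41) p.266, (55)–(58) pp.269–270, p.272).
-/

set_option autoImplicit false

noncomputable section

namespace Summit.QuantumFields.YangMills.Theorems

open MeasureTheory Filter
open Literature.MathematicalPhysics.QuantumFieldTheory.Balaban1983to89
open Literature.MathematicalPhysics.QuantumFieldTheory.Balaban1983to89.B10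
open Literature.MathematicalPhysics.QuantumFieldTheory.Balaban1983to89.B10SectAGathering
open Literature.MathematicalPhysics.QuantumFieldTheory.Balaban1983to89.AveragingRT (rnTransport)
open Literature.MathematicalPhysics.QuantumFieldTheory.Balaban1983to89.T3ContinuumYM3Torus
open Literature.MathematicalPhysics.QuantumFieldTheory.Balaban1983to89.T3UnitLawDensityEML (ℰp rt)
open Literature.MathematicalPhysics.QuantumFieldTheory.Balaban1983to89.T3UnitScaleTilt (θBal)
open Literature.MathematicalPhysics.QuantumFieldTheory.Balaban1983to89.T3LevelShift (fieldShift)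
open Literature.MathematicalPhysics.QuantumFieldTheory.Balaban1983to89.T3PrintedRegularMinimiser
open Literature.MathematicalPhysics.QuantumFieldTheory.Balaban1983to89.T3AlphaInputsAC
open Literature.MathematicalPhysics.QuantumFieldTheory.Balaban1983to89.T3AlphaInputsACTrivEnvelope
open Literature.MathematicalPhysics.QuantumFieldTheory.Balaban1985CMP102
open Literature.MathematicalPhysics.QuantumFieldTheory.Balaban1985CMP102.Setting
open Summit.QuantumFields.Balaban3D.Carriers
open Summit.QuantumFields.Balaban3D.Proofs.Primitives
open Summit.QuantumFields.Balaban3D.Proofs.TowerAC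
open Summit.QuantumFields.Balaban3D.Proofs.StandardAC
open Summit.QuantumFields.Balaban3D.Proofs.InputsAC
open Summit.QuantumFields.Balaban3D.Proofs.Bound55AC
open Summit.QuantumFields.Balaban3D.Proofs.Bound55Masses (chiB chiB_nonneg chiB_le_one measurable_chiB)
open Summit.QuantumFields.Balaban3D.Proofs (Bound55Std.measurable_actionEta Bound55Std.actionEta_nonneg)
open Summit.QuantumFields.YangMills.Theorems.LogComparisonRepAtHeights
open Summit.QuantumFields.YangMills.Theorems.AlphaV3AC (stepResidualsV3Core_of_alpha expo5558_le_expo41_succ_CoreAC)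

/-! ## §1 The upper one-step trivial envelope of the v3 datum from the package's own trivial-history row -/

section Upper

variable {F : T3Family} {𝔠 : AlphaConsts F.L (suGroupModel 2).N} {γ : ℝ} {hγ : 0 < γ} {hγ1 : γ ≤ (min 𝔠.gamma0 1) ^ 2}
  (p : ∀ K, AlphaInputsT3AC.PkgCoreRows F 𝔠 γ hγ hγ1 K) (π : AlphaInputsT3AC.PolymerT3 F)

open Classical in
/-- **THE UPPER ONE-STEP TRIVIAL ENVELOPE OF THE ROWS FAMILY DATUM — PROVED FROM THE MEMBER'S OWN STEP ROWS**: for every run `K` and step `k < K`,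
`OneStepUpperTrivAt (dataOfCoreRows p π) 𝔠.b₀ 𝔠.p₀ K k` — the row `(runRows.steps k hk).fibre55Win (Hist.triv …)` at the trivial new history (mass-free by
`fibre55Triv_of_fibre55WinAC`), the exponent step `expo5558_le_expo41_succ_CoreAC ∘ stepResidualsV3Core_of_alpha` at `triv′`, homogeneity of the transport for `e^{E}`, and the window dictionary
(`…RepAtHeightsCoreV3FamUpper`'s proof verbatim over the rows record).
[cite: Balaban1985UV3, (41) p.266 and (55)-(58) pp.269-270] -/
theorem AlphaInputsT3AC.dataOfCoreRows_oneStepUpperTrivAt (K k : ℕ) (hk : k + 1 ≤ K) :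
    OneStepUpperTrivAt (AlphaInputsT3AC.dataOfCoreRows p π) 𝔠.b₀ 𝔠.p₀ K k hk := by
  -- the package's data of run `K`, its v3 step row at `k` at the trivial new history (mass-free form), the exponent step
  have st := (p K).runRows.steps k hk
  have hkm : k + 1 ≤ F.m + K := by omega
  have hkm' : k ≤ (F.P K).m + (F.P K).K := by
    show k ≤ F.m + K
    omega
  have h49 := fibre55Triv_of_fibre55WinAC 𝔠.lane (p K).X (p K).𝔖
    (AlphaInputsT3AC.admWindowT3 F 𝔠 γ hγ hγ1 K) k hkm' (st.fibre55Win (Hist.triv (F.P K) (k + 1)))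
    (fun U hU => AlphaInputsT3AC.wtP_admWindowT3_triv_eq_one hγ1 (p K).X k (by omega) U hU)
  have hgath := fun U => expo5558_le_expo41_succ_CoreAC 𝔠.lane (p K).X (p K).𝔖 k hk
    (stepResidualsV3Core_of_alpha (T3Scales_window F 𝔠 γ hγ hγ1 K) k hk st) (Hist.triv (F.P K) (k + 1)) U
  -- abbreviations in the tower's letters
  let T : TowerRun := (p K).T
  let E : ℝ := (p K).E
  let Pc := piecesAC 𝔠.lane (p K).X (p K).𝔖 k
  let S₃ := T3Scales F γ hγ (hγ1.trans (sq_min_one_le _ 𝔠.gamma0_pos)) K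
  -- the averaging of the package IS the route's
  have hav : ∀ j, j + 1 ≤ F.m + K → ((p K).X).av j = BlockAveraging.blockAvg (P := F.P K) (j := j) ℰp :=
    fun j hj => avT3_of_le F K hj
  have hrtT : ∀ g : GaugeField (F.P K) k (Matrix.specialUnitaryGroup (Fin 2) ℂ) → ℝ,
      (rt F K k hkm).T g = rnTransport (((p K).X).av k).avg g := fun g => by
    rw [hav k hkm]; rfl
  have hε1 : eps1Of S₃ 𝔠.lane.carrier k = θBal F.L γ 𝔠.b₀ 𝔠.p₀ (K - k) :=
    (coreRows_towerFacts (p K) k (by omega)).1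
  -- the (41)-trivial integrand and its relation to the upper envelope of the datum
  let g : GaugeField (F.P K) k (Matrix.specialUnitaryGroup (Fin 2) ℂ) → ℝ := fun U =>
    Real.exp (-(T.mainT k (T.triv k) U) + T.Pint k (T.triv k) U - T.Ecst k + T.Zterm k (T.triv k) + T.Rm k)
  have hZk : T.Zterm k (T.triv k) = 0 := T.Zterm_triv k
  have hup_eq : ∀ U, upperTriv (AlphaInputsT3AC.dataOfCoreRows p π) K k U = Real.exp E * g U := by
    intro U
    rw [upperTriv_eq_exp]
    show Real.exp ((-(T.mainT k (T.triv k) U) + T.Pint k (T.triv k) U - (T.Ecst k - E)) + T.Rm k) =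
      Real.exp E * Real.exp (-(T.mainT k (T.triv k) U) + T.Pint k (T.triv k) U - T.Ecst k + T.Zterm k (T.triv k) + T.Rm k)
    rw [hZk, ← Real.exp_add]
    congr 1
    ring
  -- the window weight of the AC tower at the trivial new history
  let χ : GaugeField (F.P K) k (Matrix.specialUnitaryGroup (Fin 2) ℂ) → ℝ := fun U =>
    chiB 𝔠.lane.carrier.M₁ (rcolOf S₃ 𝔠.lane.carrier) (eps1Of S₃ 𝔠.lane.carrier) k (Hist.triv (F.P K) (k + 1)) U
  let cg : GaugeField (F.P K) k (Matrix.specialUnitaryGroup (Fin 2) ℂ) → ℝ := fun U => χ U * g U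
  -- the (49)-factor at the trivial new history IS the window indicator of level `k`
  have hchiB : ∀ (f : GaugeField (F.P K) k (Matrix.specialUnitaryGroup (Fin 2) ℂ) → ℝ) (U : GaugeField (F.P K) k (Matrix.specialUnitaryGroup (Fin 2) ℂ)),
      χ U * f U = {W' : GaugeField (F.P K) k (Matrix.specialUnitaryGroup (Fin 2) ℂ) | PlaqSmall (θBal F.L γ 𝔠.b₀ 𝔠.p₀ (K - k)) W'}.indicator f U := by
    intro f U
    have e : χ U = if PlaqSmall (eps1Of S₃ 𝔠.lane.carrier k) U then 1 else 0 :=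
      Balaban3D.Proofs.FibreClash.chiB_triv_eq (S := S₃) k 𝔠.lane.carrier.M₁ (rcolOf S₃ 𝔠.lane.carrier) (eps1Of S₃ 𝔠.lane.carrier) U
    rw [e, hε1]
    by_cases hU : PlaqSmall (θBal F.L γ 𝔠.b₀ 𝔠.p₀ (K - k)) U
    · rw [if_pos hU, one_mul, Set.indicator_of_mem (show U ∈ {W' | PlaqSmall (θBal F.L γ 𝔠.b₀ 𝔠.p₀ (K - k)) W'} from hU)]
    · rw [if_neg hU, zero_mul, Set.indicator_of_notMem (show U ∉ {W' | PlaqSmall (θBal F.L γ 𝔠.b₀ 𝔠.p₀ (K - k)) W'} from hU)]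
  -- integrability of `χ·g`
  have hmain : ∀ U, T.mainT k (T.triv k) U = (S₃.gk k)⁻¹ ^ 2 * S₃.actionEta k ((p K).UkH k (Hist.triv (F.P K) k) U) :=
    fun _ => rfl
  have hgi : Integrable cg (fieldMeasure (F.P K) k (Matrix.specialUnitaryGroup (Fin 2) ℂ)) := by
    refine Balaban3D.Proofs.Transport48.integrable_weight_mul_exp (measurable_chiB _ _ _ k _) (chiB_nonneg _ _ _ k _) (chiB_le_one _ _ _ k _)
      ?_ (c := (p K).𝔄.cP k - T.Ecst k + T.Zterm k (T.triv k) + T.Rm k) ?_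
    · simp_rw [hmain]
      exact ((((measurable_const.mul ((Bound55Std.measurable_actionEta (S := S₃) k).comp (st.hU _))).neg.add (st.hPm _)).sub
        measurable_const).add measurable_const).add measurable_const
    · intro U
      have h0 : 0 ≤ T.mainT k (T.triv k) U := by
        rw [hmain]; exact mul_nonneg (sq_nonneg _) (Bound55Std.actionEta_nonneg (S := S₃) k _)
      have h2 : T.Pint k (T.triv k) U ≤ (p K).𝔄.cP k := st.hPb _ U
      linarith
  -- homogeneity for the route normalisation `e^{E}`
  have hhom := rnTransport_const_mul_ae (((p K).X).av k).avg cg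
    (fun U => mul_nonneg (chiB_nonneg _ _ _ k _ U) (Real.exp_pos _).le) hgi (Real.exp_nonneg E)
  -- the restricted upper envelope of level `k` IS `e^{E}·χ·g`
  have hind : {W' : GaugeField (F.P K) k (Matrix.specialUnitaryGroup (Fin 2) ℂ) | PlaqSmall (θBal F.L γ 𝔠.b₀ 𝔠.p₀ (K - k)) W'}.indicator
      (upperTriv (AlphaInputsT3AC.dataOfCoreRows p π) K k) = fun U => Real.exp E * cg U := by
    funext U
    rw [← hchiB _ U, hup_eq U]
    show χ U * (Real.exp E * g U) = Real.exp E * (χ U * g U)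
    ring
  -- the goal
  show ∀ᵐ W ∂fieldMeasure (F.P K) (k + 1) (Matrix.specialUnitaryGroup (Fin 2) ℂ),
    PlaqSmall (θBal F.L γ 𝔠.b₀ 𝔠.p₀ (K - (k + 1))) W →
      (rt F K k hkm).T ({W' : GaugeField (F.P K) k (Matrix.specialUnitaryGroup (Fin 2) ℂ) |
          PlaqSmall (θBal F.L γ 𝔠.b₀ 𝔠.p₀ (K - k)) W'}.indicator (upperTriv (AlphaInputsT3AC.dataOfCoreRows p π) K k)) W ≤
        upperTriv (AlphaInputsT3AC.dataOfCoreRows p π) K (k + 1) W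
  rw [hind, hrtT]
  filter_upwards [h49, hhom] with W h49W hhomW
  intro _
  have hup1 : upperTriv (AlphaInputsT3AC.dataOfCoreRows p π) K (k + 1) W =
      Real.exp E * Real.exp (-(T.mainT (k + 1) (T.triv (k + 1)) W) + T.Pint (k + 1) (T.triv (k + 1)) W - T.Ecst (k + 1)
        + T.Zterm (k + 1) (T.triv (k + 1)) + T.Rm (k + 1)) := by
    rw [upperTriv_eq_exp, T.Zterm_triv (k + 1)]
    show Real.exp ((-(T.mainT (k + 1) (T.triv (k + 1)) W) + T.Pint (k + 1) (T.triv (k + 1)) W - (T.Ecst (k + 1) - E)) + T.Rm (k + 1)) = _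
    rw [← Real.exp_add]
    congr 1
    ring
  have key : rnTransport (((p K).X).av k).avg cg W ≤
      Real.exp (-(T.mainT (k + 1) (T.triv (k + 1)) W) + T.Pint (k + 1) (T.triv (k + 1)) W - T.Ecst (k + 1)
        + T.Zterm (k + 1) (T.triv (k + 1)) + T.Rm (k + 1)) :=
    calc rnTransport (((p K).X).av k).avg cg W
        ≤ Real.exp (-(T.mainT (k + 1) (T.triv (k + 1)) W) - T.Ecst k
              + (Pc.logσ₀ + Pc.dg * Real.log (T.g k)) * Pc.starB (T.triv (k + 1)) + Pc.logZU (T.triv (k + 1)) W + Pc.Pold (T.triv (k + 1)) W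
              + T.Zterm k (Pc.proj (T.triv (k + 1))) + T.Rm k + Pc.logFl (T.triv (k + 1)) W) := h49W
      _ ≤ Real.exp (-(T.mainT (k + 1) (T.triv (k + 1)) W) + T.Pint (k + 1) (T.triv (k + 1)) W - T.Ecst (k + 1)
              + T.Zterm (k + 1) (T.triv (k + 1)) + T.Rm (k + 1)) := Real.exp_le_exp.mpr (hgath W)
  rw [hup1]
  calc rnTransport (((p K).X).av k).avg (fun U => Real.exp E * cg U) W
      = Real.exp E * rnTransport (((p K).X).av k).avg cg W := hhomW
    _ ≤ Real.exp E * Real.exp (-(T.mainT (k + 1) (T.triv (k + 1)) W) + T.Pint (k + 1) (T.triv (k + 1)) W - T.Ecst (k + 1)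
        + T.Zterm (k + 1) (T.triv (k + 1)) + T.Rm (k + 1)) := mul_le_mul_of_nonneg_left key (Real.exp_nonneg E)

end Upper

end Summit.QuantumFields.YangMills.Theorems

end
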